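import Literature.AnabelianGeometry.Anabelioids.FiberFunctorUnique
import Mathlib.CategoryTheory.Galois.Full
import Mathlib.CategoryTheory.Limits.Types.Products
import HarnessLib

/-!
# Anabelioids: "universal coverings" — objects with free fundamental-group action

Mochizuki, *Semi-graphs of anabelioids*, Publ. RIMS **42** (2006), §2, proof of Proposition 2.5,
author's manuscript p. 27 [cite: MochizukiSemiAnbd2006, Prop. 2.5 p.27]: for a connected anabelioid
`𝒢_v` with FINITE `π̂₁(𝒢_v)` one takes "the union of `M/[π̂₁(𝒢_v) : 1]` copies of some 'universal
covering' of `𝒢_v` [i.e., the finite étale covering determined by the trivial subgroup of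
`π̂₁(𝒢_v)`]", and "by choosing appropriate gluing isomorphisms" identifies two such unions of the
same degree.  This proof-only file supplies these two steps for a Galois category `C` with fibre
functor `F` and finite `Aut F` (freeness of the `π₁`-action on a fibre is written out as
`∀ σ x, σ • x = x → σ = 1` for Mathlib's action `PreGaloisCategory.mulAction_def`):

* `exists_card_fiber_eq` — objects with any prescribed fibre cardinality;
* `exists_isGalois_free` — a Galois object on whose fibre `Aut F` acts freely (a "universal
  covering"), `exists_free_card_eq` — a free object of fibre cardinality `k · |Aut F|`;
* `nonempty_iso_of_free` — two free objects with fibres of the same cardinality are isomorphic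
  (free finite `G`-sets of equal cardinality are isomorphic; full faithfulness of
  `functorToAction`, [SGA1] V §4);
* `free_of_iso_fiberFunctor`, `free_comp_of_injective` — freeness is independent of the basepoint
  and passes to `φ^* X` along a `π₁`-monomorphism `φ`.
-/

namespace Literature.AnabelianGeometry.Anabelioids

open CategoryTheory CategoryTheory.Limits CategoryTheory.PreGaloisCategory

universe u₁ u₂ w

/-! ### Free finite `G`-sets of equal cardinality are isomorphic -/

/-- Two finite sets with free actions of a finite group `G` and the same cardinality are
`G`-equivariantly in bijection (both are `(number of orbits) × G`). [folklore] -/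
private theorem exists_equivariant_equiv_of_free {G : Type*} [Group G] [Finite G]
    {X Y : Type w} [Finite X] [Finite Y] [MulAction G X] [MulAction G Y]
    (hX : ∀ (g : G) (x : X), g • x = x → g = 1) (hY : ∀ (g : G) (y : Y), g • y = y → g = 1)
    (hc : Nat.card X = Nat.card Y) : ∃ e : X ≃ Y, ∀ (g : G) (x : X), e (g • x) = g • e x := by
  classical
  -- trivialisations `Ω × G ≃ X` by a section of the orbit map
  have triv : ∀ (Z : Type w) [Finite Z] [MulAction G Z], (∀ (g : G) (z : Z), g • z = z → g = 1) →
      ∃ (Ω : Type w) (_ : Finite Ω) (t : Ω × G ≃ Z), ∀ g ω h, t (ω, g * h) = g • t (ω, h) := by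
    intro Z _ _ hZ
    let Ω := MulAction.orbitRel.Quotient G Z
    let s : Ω → Z := fun ω => ω.out
    have hs : ∀ z : Z, ∃ g : G, g • s (Quotient.mk'' z : Ω) = z := fun z => by
      have h : (MulAction.orbitRel G Z) (s (Quotient.mk'' z)) z :=
        Quotient.exact' (Quotient.out_eq' (Quotient.mk'' z : Ω))
      obtain ⟨g, hg⟩ := MulAction.orbitRel_apply.mp h
      refine ⟨g⁻¹, ?_⟩
      have hg' : g • z = s (Quotient.mk'' z) := hg
      rw [← hg', inv_smul_smul]
    let t : Ω × G → Z := fun p => p.2 • s p.1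
    have hinj : Function.Injective t := by
      rintro ⟨ω₁, g₁⟩ ⟨ω₂, g₂⟩ h
      change g₁ • s ω₁ = g₂ • s ω₂ at h
      have hω : ω₁ = ω₂ := by
        rw [← Quotient.out_eq' ω₁, ← Quotient.out_eq' ω₂]
        apply Quotient.sound'
        change (MulAction.orbitRel G Z) (s ω₁) (s ω₂)
        rw [MulAction.orbitRel_apply]
        refine ⟨g₁⁻¹ * g₂, ?_⟩
        show (g₁⁻¹ * g₂) • s ω₂ = s ω₁
        rw [mul_smul, ← h, inv_smul_smul]
      subst hω
      have : (g₂⁻¹ * g₁) • s ω₁ = s ω₁ := by rw [mul_smul, h, inv_smul_smul]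
      have hg := hZ _ _ this
      rw [inv_mul_eq_one] at hg
      rw [hg]
    have hsurj : Function.Surjective t := fun z => by
      obtain ⟨g, hg⟩ := hs z
      exact ⟨(Quotient.mk'' z, g), hg⟩
    haveI : Finite Ω := Quotient.finite _
    exact ⟨Ω, inferInstance, Equiv.ofBijective t ⟨hinj, hsurj⟩, fun g ω h => by
      change (g * h) • s ω = g • h • s ω
      rw [mul_smul]⟩
  obtain ⟨ΩX, _, tX, htX⟩ := triv X hX
  obtain ⟨ΩY, _, tY, htY⟩ := triv Y hY
  -- the orbit sets have the same cardinality
  have hG : 0 < Nat.card G := Nat.card_pos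
  have hΩ : Nat.card ΩX = Nat.card ΩY := by
    have h1 := Nat.card_congr tX
    have h2 := Nat.card_congr tY
    rw [Nat.card_prod] at h1 h2
    have : Nat.card ΩX * Nat.card G = Nat.card ΩY * Nat.card G := by rw [h1, h2, hc]
    exact Nat.eq_of_mul_eq_mul_right hG this
  haveI := Fintype.ofFinite ΩX
  haveI := Fintype.ofFinite ΩY
  have eΩ : ΩX ≃ ΩY := Fintype.equivOfCardEq (by
    rw [← Nat.card_eq_fintype_card, ← Nat.card_eq_fintype_card, hΩ])
  refine ⟨tX.symm.trans ((eΩ.prodCongr (Equiv.refl G)).trans tY), fun g x => ?_⟩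
  obtain ⟨⟨ω, h⟩, rfl⟩ := tX.surjective x
  rw [← htX]
  simp only [Equiv.trans_apply, Equiv.symm_apply_apply, Equiv.prodCongr_apply, Prod.map,
    Equiv.refl_apply]
  exact htY g (eΩ ω) h

section

variable {C : Type u₁} [Category.{u₂} C] [GaloisCategory C] (F : C ⥤ FintypeCat.{w})
  [FiberFunctor F]

/-- Points of the fibre of a binary product are determined by their projections. [folklore] -/
private theorem fiber_prod_ext' {B S : C} {p q : F.obj (B ⨯ S)}
    (h₁ : F.map prod.fst p = F.map prod.fst q) (h₂ : F.map prod.snd p = F.map prod.snd q) :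
    p = q := by
  have hp : ∀ r : F.obj (B ⨯ S),
      fiberBinaryProductEquiv F B S r = (F.map prod.fst r, F.map prod.snd r) := fun r => by
    obtain ⟨⟨a, c⟩, rfl⟩ := (fiberBinaryProductEquiv F B S).symm.surjective r
    simp
  apply (fiberBinaryProductEquiv F B S).injective
  rw [hp, hp, h₁, h₂]

/-- The fibre of a terminal object is a point. [folklore] -/
private theorem card_fiber_terminal : Nat.card (F.obj (⊤_ C)) = 1 := by
  obtain ⟨hU⟩ : Nonempty (Unique (F.obj (⊤_ C))) :=
    ⟨Types.isTerminalEquivUnique ((F ⋙ FintypeCat.incl).obj (⊤_ C))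
      (IsTerminal.isTerminalObj (F ⋙ FintypeCat.incl) (⊤_ C) terminalIsTerminal)⟩
  exact Nat.card_unique

/-- A Galois category has objects of every fibre cardinality (disjoint unions of copies of the
terminal object). [folklore] -/
private theorem exists_card_fiber_eq (k : ℕ) : ∃ T : C, Nat.card (F.obj T) = k := by
  induction k with
  | zero =>
    refine ⟨⊥_ C, ?_⟩
    haveI : IsEmpty (F.obj (⊥_ C)) := (initial_iff_fiber_empty F (⊥_ C)).mp ⟨initialIsInitial⟩
    simp
  | succ k ih =>
    obtain ⟨T, hT⟩ := ih
    exact ⟨T ⨿ ⊤_ C, by rw [card_fiber_coprod_eq_sum, hT, card_fiber_terminal]⟩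

/-- **A "universal covering" of a connected anabelioid with finite `π₁`** ([SemiAnbd] proof of
Prop. 2.5, p. 27: "the finite étale covering determined by the trivial subgroup of `π̂₁(𝒢_v)`"):
if `Aut F` is finite there is a Galois object `A` on whose fibre `Aut F` acts freely (and
transitively), so that `|F(A)| = |Aut F|`. [cite: MochizukiSemiAnbd2006, Prop. 2.5 p.27] -/
theorem exists_isGalois_free [Finite (Aut F)] :
    ∃ A : C, IsGalois A ∧ (∀ (σ : Aut F) (x : F.obj A), σ • x = x → σ = 1) ∧
      Nat.card (F.obj A) = Nat.card (Aut F) := by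
  classical
  -- `{1}` is an open neighbourhood of `1` in the finite (discrete) profinite group `Aut F`
  obtain ⟨I, hfin, hc, hi⟩ := exists_set_ker_evaluation_subset_of_isOpen F
    (H := {(1 : Aut F)}) rfl (isOpen_discrete _)
  haveI : ∀ X : I, IsConnected X.val := fun X => hc X X.property
  haveI : ∀ X : I, Nonempty (F.obj X.val) := fun X => nonempty_fiber_of_isConnected F X
  have hn : Nonempty (F.obj (∏ᶜ fun X : I => (X : C))) :=
    nonempty_fiber_pi_of_nonempty_of_finite F _
  obtain ⟨A, f, hA⟩ :=
    exists_hom_from_galois_of_fiber_nonempty F (∏ᶜ fun X : I => (X : C)) hn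
  haveI := hA
  -- freeness: an element fixing a point of `F(A)` fixes `F(A)` (Galois), hence each `F(X)`, `X ∈ I`
  have hfree : ∀ (σ : Aut F) (a : F.obj A), σ • a = a → σ = 1 := by
    intro σ a ha
    have hA' : ∀ x : F.obj A, σ • x = x := fun x => by
      obtain ⟨φ, rfl⟩ := MulAction.exists_smul_eq (Aut A) a x
      change σ • F.map φ.hom a = F.map φ.hom a
      rw [mulAction_naturality, ha]
    have h2 : ∀ X : I, σ.hom.app X = 𝟙 (F.obj X) := by
      intro ⟨X, hX⟩
      haveI : IsConnected X := hc X hX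
      ext x
      let p : A ⟶ X := f ≫ Pi.π (fun Z : I => (Z : C)) ⟨X, hX⟩
      obtain ⟨a', rfl⟩ := surjective_of_nonempty_fiber_of_isConnected F p x
      simp only [FintypeCat.id_apply]
      change σ • F.map p a' = F.map p a'
      rw [mulAction_naturality, hA' a']
    exact hi σ h2
  refine ⟨A, hA, hfree, ?_⟩
  -- `σ ↦ σ • a₀` is a bijection `Aut F ≃ F(A)` (free and transitive)
  obtain ⟨a₀⟩ := nonempty_fiber_of_isConnected F A
  refine (Nat.card_congr (Equiv.ofBijective (fun σ : Aut F => σ • a₀) ⟨?_, ?_⟩)).symm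
  · intro σ τ h
    have : (τ⁻¹ * σ) • a₀ = a₀ := by
      rw [mul_smul, show σ • a₀ = τ • a₀ from h, inv_smul_smul]
    have h1 := hfree _ _ this
    rw [inv_mul_eq_one] at h1
    exact h1.symm
  · intro x
    exact MulAction.exists_smul_eq (Aut F) a₀ x

/-- Free objects of fibre cardinality `k · |Aut F|` ("the union of `M/[π̂₁(𝒢_v) : 1]` copies of
some universal covering", [SemiAnbd] p. 27): the product of a universal covering with an object of
fibre cardinality `k`. [cite: MochizukiSemiAnbd2006, Prop. 2.5 p.27] -/
theorem exists_free_card_eq [Finite (Aut F)] (k : ℕ) :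
    ∃ X : C, (∀ (σ : Aut F) (x : F.obj X), σ • x = x → σ = 1) ∧
      Nat.card (F.obj X) = k * Nat.card (Aut F) := by
  obtain ⟨A, _, hfree, hcard⟩ := exists_isGalois_free F
  obtain ⟨T, hT⟩ := exists_card_fiber_eq F k
  refine ⟨T ⨯ A, fun σ x hx => hfree σ (F.map prod.snd x) ?_, ?_⟩
  · rw [mulAction_naturality, hx]
  · rw [Nat.card_congr (fiberBinaryProductEquiv F T A), Nat.card_prod, hT, hcard]

/-- **Gluing free objects** ([SemiAnbd] proof of Prop. 2.5, p. 27, "by choosing appropriate gluing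
isomorphisms"): two objects on whose fibres the finite group `Aut F` acts freely, with fibres of
the same cardinality, are isomorphic. [cite: MochizukiSemiAnbd2006, Prop. 2.5 p.27] -/
theorem nonempty_iso_of_free [Finite (Aut F)] {X Y : C}
    (hX : ∀ (σ : Aut F) (x : F.obj X), σ • x = x → σ = 1)
    (hY : ∀ (σ : Aut F) (y : F.obj Y), σ • y = y → σ = 1)
    (hc : Nat.card (F.obj X) = Nat.card (F.obj Y)) : Nonempty (X ≅ Y) := by
  obtain ⟨e, he⟩ := exists_equivariant_equiv_of_free hX hY hc
  -- the equivariant bijection is an isomorphism of `Aut F`-sets, hence comes from `C`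
  let i : (functorToAction F).obj X ≅ (functorToAction F).obj Y :=
    Action.mkIso (FintypeCat.equivEquivIso e) fun σ => by
      ext x
      exact he σ x
  exact ⟨(Functor.FullyFaithful.ofFullyFaithful (functorToAction F)).preimageIso i⟩

end

section Transfer

variable {X : Type u₁} [Category.{u₂} X]

/-- Freeness of the `π₁`-action on a fibre does not depend on the basepoint: it transfers along an
isomorphism of fibre functors. [cite: MochizukiGeoAn2004, §1.1 p.10] -/
theorem free_of_iso_fiberFunctor {F F' : X ⥤ FintypeCat.{w}} (e : F ≅ F') {A : X}
    (h : ∀ (σ : Aut F) (x : F.obj A), σ • x = x → σ = 1) :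
    ∀ (σ : Aut F') (x : F'.obj A), σ • x = x → σ = 1 := by
  intro σ x hx
  obtain ⟨τ, rfl⟩ := e.conjAut.surjective σ
  have : τ • e.inv.app A x = e.inv.app A x := by
    rw [mulAction_def] at hx ⊢
    have h1 := congrArg (e.inv.app A) hx
    rw [Iso.conjAut_hom, Iso.conj_apply] at h1
    simpa [FintypeCat.comp_apply] using h1
  rw [h τ _ this, map_one]

/-- The fibre cardinality does not depend on the basepoint. [cite: MochizukiGeoAn2004, §1.1 p.10] -/
theorem card_fiber_eq_of_iso_fiberFunctor {F F' : X ⥤ FintypeCat.{w}} (e : F ≅ F') (A : X) :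
    Nat.card (F.obj A) = Nat.card (F'.obj A) :=
  Nat.card_congr (FintypeCat.equivEquivIso.symm (e.app A))

variable {Y : Type*} [Category Y]

/-- Freeness passes along a `π₁`-monomorphism: if `π₁(φ) : Aut F → Aut (φ^* ⋙ F)` is injective and
`Aut (φ^* ⋙ F)` acts freely on the fibre of `S`, then `Aut F` acts freely on the fibre of `φ^* S`
(the same finite set). [cite: MochizukiGeoAn2004, Def. 1.1.7(ii) p.14] -/
theorem free_comp_of_injective (P : Y ⥤ X) (F : X ⥤ FintypeCat.{w})
    (hP : Function.Injective (pi1Map P F)) {S : Y}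
    (h : ∀ (σ : Aut (P ⋙ F)) (x : (P ⋙ F).obj S), σ • x = x → σ = 1) :
    ∀ (τ : Aut F) (x : F.obj (P.obj S)), τ • x = x → τ = 1 := by
  intro τ x hx
  apply hP
  rw [map_one]
  exact h (pi1Map P F τ) x hx

end Transfer

end Literature.AnabelianGeometry.Anabelioids
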